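import Summits.ResolutionOfSingularities.ResolutionOfSingularities.Theorems.PurelyInseparableDim4ParamLiftRel
import Summits.ResolutionOfSingularities.ResolutionOfSingularities.Theorems.PurelyInseparableDim4ParamCert
import HarnessLib

/-!
# [OURS · res-dim4-pi · F4-C-loc] PARAMETRIC CERTIFICATES, format v4 (part 1: the FORMAT): chart certificates as TREES —
  product forcing with several branches, PAIR and RELATION nodes, rational roots that are dead, COAT-blind rows

Cell `res-dim4-pi` (D-0157 DOOR 2, wave 2), seat `res-dim4-p-6` g3.  The symbolic census of the LOCAL in-scope game at
`(3,3)` on 2-monomial roots (WORD #92 (d); CANDIDATE, one engine) wins ≈ 97 % of the 3 782 classes uniformly over every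
field, but most plans use shapes the v3 format (`…ParamCert`: LINEAR forcing chains) cannot carry.  v4 keeps v3's rows
(`Terms 5 k`, letter index 4, `spec f β`) and row kinds (blind | move), adds the COAT row (res-dim4-p-8 g3's
monomial-coat lemma `ScopeBlind.not_inCoordinateScope_monomialCoat_evalT`, lifted along `f`), and replaces the chart
chain by a TREE `PNode`:

* `dead γ` (`pwitB`) · `child` (`U = ∅`; origin child `0` or a later row) · `free i` (as v3) ·
  `root γ i ρ (atRho : Option γ')` (as v3; with `some γ'` the rational point `f ρ·δᵢ` is itself DEAD: `pwitB` on the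
  translated chart with no freedom) · `pair γ i i' ρ d sub` (`ppairB`: `bᵢ = f ρ·b_{i'}^d`; `b_{i'} = 0` continues in
  `sub`, `b_{i'} = β' ≠ 0` gives the child `clean4 (shearMonoL i ρ d (shearL i' G))` read at `β'`, a later row) ·
  `rel γ γ' zs nu κ subs` (`prelB`: some `bᵢ = 0`, `i ∈ zs`; a subtree per `i`) · `split γ subs` (`psplitB`: ONE source,
  several moving letters: some listed `bᵢ = 0`; a subtree per `i`).
* checkers `pnodeB` / `pforestB` (mutual structural recursion over the nested inductive), `prow4B`, **`pcert4B`**;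
  the soundness theorem is part 2 (`…ParamCertTreeSound`).
* helper checks with their meaning: **`psplitB` ⇒ `exists_zero_of_psplitB`**; the COAT row check `pcoatB` (t-free row,
  a degree-`q−1` monomial `x^m` dividing every term, and the three coefficient facts of the monomial-coat lemma on the
  `T`-free part of the quotient, `T = supp m`).

[OURS · counted 0 · certificate format; AI kernel work, weaker than expert review.]  NOTHING here is a statement about
resolution of singularities; resolution in dimension `≥ 4` / characteristic `p > 0` is NOT proved by anything in this
file.  bears_on: LADDER-RESOLUTION:D157-DOOR2 (res-dim4-pi · F4-C-loc all fields · parametric rows).  Host item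
(DR-157-C): `stmt-ResolutionOfSingularities-16155`, helper.
-/

set_option linter.dupNamespace false -- mandated namespace of this single-conjunct summit

noncomputable section

open MvPolynomial Finset
open scoped BigOperators

namespace Summit.ResolutionOfSingularities.ResolutionOfSingularities.Theorems.PIDim4

namespace LoopCLocal

open Literature.AlgebraicGeometry.Resolution
open Literature.AlgebraicGeometry.Resolution.CentreBlowup
open StepKit ParamLift

section Checks

variable {k K : Type} [Field k] [Field K] [DecidableEq k] [DecidableEq K] (f : k →+* K) (β : K)

/-! ## §1 Two more chart checks: product forcing with several letters; the coat row -/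

/-- **product-forcing check**: `γ` low, ONE source term (single), non-zero binomials and coefficient, whose moving
letters are exactly `is ≠ ∅` — so its Taylor term is `f(c)β^a·K·∏_{i∈is} bᵢ^{dᵢ}`, `dᵢ ≥ 1`. OURS. [folklore] -/
def psplitB (q : ℕ) (U : Finset (Fin 4)) (G : Terms 5 k) (γ : Fin 4 → ℕ) (is : Finset (Fin 4)) : Bool :=
  !decide (γ = 0) && decide (∑ m, γ m < q) && decide (is.Nonempty) &&
    match srcTerms U γ G with
    | [t] => decide (moves γ t.1 = is) && !decide (t.2 * binomK γ t.1 = (0 : k))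
    | _ => false

omit [Field K] [DecidableEq K] in
/-- the low-exponent data of a product-forcing check. OURS. [folklore] -/
theorem psplitB_low {q : ℕ} {U : Finset (Fin 4)} {G : Terms 5 k} {γ : Fin 4 → ℕ} {is : Finset (Fin 4)}
    (h : psplitB q U G γ is = true) : γ ≠ 0 ∧ ∑ m, γ m < q := by
  unfold psplitB at h
  simp only [Bool.and_eq_true, Bool.not_eq_true', decide_eq_false_iff_not, decide_eq_true_eq] at h
  exact ⟨h.1.1.1, h.1.1.2⟩

omit [DecidableEq K] in
/-- **product forcing**: if the coefficient of `x^γ` vanishes at `b` (vanishing off `U`), some listed letter vanishes.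
OURS. [folklore] -/
theorem exists_zero_of_psplitB {q : ℕ} {U : Finset (Fin 4)} {G : Terms 5 k} {γ : Fin 4 → ℕ} {is : Finset (Fin 4)}
    (hβ : β ≠ 0) (h : psplitB q U G γ is = true) {b : Fin 4 → K} (hb : ∀ m : Fin 4, m ∉ U → b m = 0)
    (hzero : coeff (expo γ) (PointBlowup.translate b (spec f β (evalT G))) = 0) : ∃ i ∈ is, b i = 0 := by
  unfold psplitB at h
  simp only [Bool.and_eq_true] at h
  obtain ⟨-, hm⟩ := h
  rw [coeff_translate_spec_evalT, sum_pterm_filter f β γ hb] at hzero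
  unfold srcTerms at hm
  split at hm
  · rename_i t heq
    rw [heq] at hzero
    simp only [Bool.and_eq_true, decide_eq_true_eq, Bool.not_eq_true', decide_eq_false_iff_not] at hm
    obtain ⟨hmv, hE⟩ := hm
    simp only [List.map_cons, List.map_nil, List.sum_cons, List.sum_nil, add_zero] at hzero
    rw [pterm_eq] at hzero
    have hne : f t.2 * β ^ t.1 (Fin.last 4) * f (binomK γ t.1) ≠ 0 :=
      mul_ne_zero (mul_ne_zero ((map_ne_zero_iff f f.injective).mpr (left_ne_zero_of_mul hE)) (pow_ne_zero _ hβ))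
        ((map_ne_zero_iff f f.injective).mpr (right_ne_zero_of_mul hE))
    have hprod : (∏ m : Fin 4, b m ^ (t.1 m.castSucc - γ m)) = 0 := (mul_eq_zero.mp hzero).resolve_left hne
    obtain ⟨m, -, hm0⟩ := Finset.prod_eq_zero_iff.mp hprod
    have hpos : t.1 m.castSucc - γ m ≠ 0 := by rintro h0; rw [h0, pow_zero] at hm0; exact one_ne_zero hm0
    refine ⟨m, ?_, (pow_eq_zero_iff hpos).mp hm0⟩
    rw [← hmv]; simp only [moves, Finset.mem_filter, Finset.mem_univ, true_and]; omega
  · exact absurd hm Bool.false_ne_true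

/-- term list with coefficients pushed along `f`. OURS. [folklore] -/
def mapC (f : k →+* K) (L : Terms 4 k) : Terms 4 K := L.map fun t => (t.1, f t.2)

omit [DecidableEq k] [DecidableEq K] in
/-- `evalT (mapC f L) = map f (evalT L)`. OURS. [folklore] -/
theorem evalT_mapC (L : Terms 4 k) : evalT (mapC f L) = MvPolynomial.map f (evalT L) := by
  induction L with
  | nil => simp [mapC]
  | cons t L ih => simp only [mapC, List.map_cons, evalT_cons, map_add, map_monomial] at ih ⊢; rw [ih]

omit [DecidableEq k] [DecidableEq K] in
/-- coefficients of `mapC`. OURS. [folklore] -/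
theorem coeffAt_mapC (L : Terms 4 k) (e : Fin 4 → ℕ) : coeffAt (mapC f L) e = f (coeffAt L e) := by
  induction L with
  | nil => simp [mapC, coeffAt]
  | cons t L ih =>
    simp only [mapC, List.map_cons, coeffAt] at ih ⊢
    rw [ih, map_add]
    by_cases h : t.1 = e
    · rw [if_pos h, if_pos h]
    · rw [if_neg h, if_neg h, map_zero]

omit [DecidableEq k] [DecidableEq K] in
/-- `mapC` commutes with exponent filters. OURS. [folklore] -/
theorem filter_mapC (p : (Fin 4 → ℕ) → Bool) (L : Terms 4 k) :
    (mapC f L).filter (fun t => p t.1) = mapC f (L.filter fun t => p t.1) := by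
  induction L with
  | nil => rfl
  | cons t L ih =>
    simp only [mapC, List.map_cons, List.filter_cons] at ih ⊢
    cases p t.1 <;> simp [ih]

/-- dividing every term by the monomial `x^m`. OURS. [folklore] -/
def divL (m : Fin 4 → ℕ) (L : Terms 4 k) : Terms 4 k := L.map fun t => (t.1 - m, t.2)

omit [DecidableEq k] in
/-- if `x^m` divides every term, `evalT L = x^m · evalT (divL m L)`. OURS. [folklore] -/
theorem evalT_eq_monomial_mul_divL {m : Fin 4 → ℕ} {L : Terms 4 k} (h : ∀ t ∈ L, ∀ i, m i ≤ t.1 i) :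
    evalT L = monomial (expo m) (1 : k) * evalT (divL m L) := by
  induction L with
  | nil => simp [divL]
  | cons t L ih =>
    have ih' := ih (fun t' ht' => h t' (List.mem_cons_of_mem _ ht'))
    show monomial (expo t.1) t.2 + evalT L =
      monomial (expo m) 1 * (monomial (expo (t.1 - m)) t.2 + evalT (divL m L))
    have hexp : expo m + expo (t.1 - m) = expo t.1 := by
      ext i
      rw [Finsupp.add_apply, expo_apply, expo_apply, expo_apply, Pi.sub_apply]
      have := h t List.mem_cons_self i
      omega
    rw [ih', mul_add, monomial_mul, one_mul, hexp]

/-- the `T`-free part of the quotient (`T = supp m`). OURS. [folklore] -/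
def coatRest (m : Fin 4 → ℕ) (L : Terms 4 k) : Terms 4 k :=
  (divL m L).filter fun t => decide (∀ i : Fin 4, m i ≠ 0 → t.1 i = 0)

/-- **COAT row check** (t-free row): `x^m` of degree `q − 1` divides every term, and on the `T`-free part of the
quotient: a non-zero coefficient at `e₀`, zero constant coefficient, and for every `i ∉ T` a non-zero coefficient at an
exponent `ex i` with `(ex i) i = 0`. OURS. [folklore] -/
def pcoatB (q : ℕ) (L : Terms 5 k) (m e₀ : Fin 4 → ℕ) (ex : Fin 4 → (Fin 4 → ℕ)) : Bool :=
  tfreeB L && decide (∑ i, m i = q - 1) && decide (∀ t ∈ trunc L, ∀ i, m i ≤ t.1 i) &&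
    !decide (coeffAt (coatRest m (trunc L)) e₀ = 0) && decide (coeffAt (coatRest m (trunc L)) 0 = 0) &&
    decide (∀ i : Fin 4, m i = 0 → (ex i) i = 0 ∧ coeffAt (coatRest m (trunc L)) (ex i) ≠ 0)

end Checks

/-! ## §2 The tree format -/

section Format

variable {k : Type} [Field k] [DecidableEq k]

/-- a chart certificate node (see the module docstring). OURS. [folklore] -/
inductive PNode (k : Type) : Type
  /-- no equimultiple point remains: witness `γ` -/
  | dead (γ : Fin 4 → ℕ)
  /-- all letters forced: origin child `0` or a later row -/
  | child
  /-- one free letter `i`: origin child and letter child are later rows -/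
  | free (i : Fin 4)
  /-- one letter `i` pinned to `{0, ρ}`; `atRho = some γ'`: the point `ρ` is dead by `γ'`, else its child is a later row -/
  | root (γ : Fin 4 → ℕ) (i : Fin 4) (ρ : k) (atRho : Option (Fin 4 → ℕ))
  /-- tie `bᵢ = f ρ·b_{i'}^d`: `b_{i'} = 0` continues in `sub`, the letter child is a later row -/
  | pair (γ : Fin 4 → ℕ) (i i' : Fin 4) (ρ : k) (d : ℕ) (sub : PNode k)
  /-- binomial relation: some `bᵢ = 0`, `i ∈ zs`; subtrees per letter -/
  | rel (γ γ' : Fin 4 → ℕ) (zs : Finset (Fin 4)) (nu : Fin 4 → ℕ) (κ : k) (subs : List (Fin 4 × PNode k))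
  /-- product forcing: some listed letter vanishes; subtrees per letter -/
  | split (γ : Fin 4 → ℕ) (subs : List (Fin 4 × PNode k))

/-- a v4 row certificate. OURS. [folklore] -/
inductive PRowCert4 (k : Type) : Type
  /-- t-free row outside the coordinate scope: monomial-curve data for `ScopeBlind.blindB` -/
  | blind (c : Fin 4 → k) (w : Fin 4 → ℕ) (α₀ : Fin 4 → ℕ) (a : Fin 4 → k)
  /-- t-free row outside the coordinate scope: a monomial coat -/
  | coat (m e₀ : Fin 4 → ℕ) (ex : Fin 4 → (Fin 4 → ℕ))
  /-- A plays `V(x_S)`; a chart tree for every `j ∈ S` -/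
  | move (S : Finset (Fin 4)) (charts : Fin 4 → PNode k)

/-- a v4 row. OURS. [folklore] -/
abbrev PRow4 (k : Type) : Type := Terms 5 k × PRowCert4 k

/-- `L` presents the same polynomial as some LATER row. OURS. [folklore] -/
def memRow4B (L : Terms 5 k) (rest : List (PRow4 k)) : Bool := rest.any fun r => StepKit.equivB L r.1

/-- a child is fine if it is `0` or a later row. OURS. [folklore] -/
def pchild4B (L : Terms 5 k) (rest : List (PRow4 k)) : Bool := StepKit.equivB L [] || memRow4B L rest

mutual
/-- the node checker against the chart data `G`, free letters `U`. OURS. [folklore] -/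
def pnodeB (q : ℕ) (rest : List (PRow4 k)) (G : Terms 5 k) : Finset (Fin 4) → PNode k → Bool
  | U, .dead γ => pwitB q U G γ
  | U, .child => decide (U = ∅) && pchild4B (clean4 q G) rest
  | U, .free i => decide (U = {i}) && tfreeB G && pchild4B (clean4 q G) rest && memRow4B (clean4 q (shearL i G)) rest
  | U, .root γ i ρ atRho => decide (U = {i}) && (prootB q U G γ i ρ || prootB q U G.reverse γ i ρ) &&
      pchild4B (clean4 q G) rest &&
      (match atRho with
        | none => memRow4B (clean4 q (transVar i.castSucc ρ G)) rest
        | some γ' => pwitB q ∅ (transVar i.castSucc ρ G) γ')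
  | U, .pair γ i i' ρ d sub => decide (U = {i, i'}) && tfreeB G && ppairB q U G γ i i' ρ d &&
      pnodeB q rest G (U.erase i') sub && memRow4B (clean4 q (shearMonoL i ρ d (shearL i' G))) rest
  | U, .rel γ γ' zs nu κ subs => prelB q U G γ γ' zs nu κ && decide (zs ⊆ (subs.map Prod.fst).toFinset) &&
      pforestB q rest G U subs
  | U, .split γ subs => psplitB q U G γ (subs.map Prod.fst).toFinset && pforestB q rest G U subs
/-- the subtree-list checker: each `(i, t)` is checked with `i` removed from the free letters. OURS. [folklore] -/
def pforestB (q : ℕ) (rest : List (PRow4 k)) (G : Terms 5 k) : Finset (Fin 4) → List (Fin 4 × PNode k) → Bool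
  | _, [] => true
  | U, (i, t) :: subs => pnodeB q rest G (U.erase i) t && pforestB q rest G U subs
end

/-- the v4 row check. OURS. [folklore] -/
def prow4B (q : ℕ) (rest : List (PRow4 k)) : PRow4 k → Bool
  | (L, PRowCert4.blind c w α₀ a) => tfreeB L && ScopeBlind.blindB q (⟨trunc L, 0, ∅⟩ : SData 4 k) c w α₀ a
  | (L, PRowCert4.coat m e₀ ex) => pcoatB q L m e₀ ex
  | (L, PRowCert4.move S ch) => ppermB q S L &&
      decide (∀ j ∈ S, pnodeB q rest (chartL q (S5 S) j.castSucc L) (S.erase j) (ch j) = true)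

/-- **the v4 certificate checker**: rows in order, children later. OURS. [folklore] -/
def pcert4B (q : ℕ) : List (PRow4 k) → Bool
  | [] => true
  | row :: rest => prow4B q rest row && pcert4B q rest

/-! ## §3 Checker v5 (append): the pair node's letter point may be DEAD (witness searched among the low exponents) -/

mutual
/-- node checker v5: as `pnodeB`, except that at a `pair` node the letter point `β'·δ_{i'} + f ρ β'^d·δᵢ` is
either a later row (its cleaned child) or DEAD — some low `γ'` passes `pwitB` on the translated chart with no freedom.
OURS. [folklore] -/
def pnode5B (q : ℕ) (rest : List (PRow4 k)) (G : Terms 5 k) : Finset (Fin 4) → PNode k → Bool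
  | U, .dead γ => pwitB q U G γ
  | U, .child => decide (U = ∅) && pchild4B (clean4 q G) rest
  | U, .free i => decide (U = {i}) && tfreeB G && pchild4B (clean4 q G) rest && memRow4B (clean4 q (shearL i G)) rest
  | U, .root γ i ρ atRho => decide (U = {i}) && (prootB q U G γ i ρ || prootB q U G.reverse γ i ρ) &&
      pchild4B (clean4 q G) rest &&
      (match atRho with
        | none => memRow4B (clean4 q (transVar i.castSucc ρ G)) rest
        | some γ' => pwitB q ∅ (transVar i.castSucc ρ G) γ')
  | U, .pair γ i i' ρ d sub => decide (U = {i, i'}) && tfreeB G && ppairB q U G γ i i' ρ d &&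
      pnode5B q rest G (U.erase i') sub &&
      (memRow4B (clean4 q (shearMonoL i ρ d (shearL i' G))) rest ||
        decide (∃ γ' ∈ UniformNoReply.lowExps q, pwitB q ∅ (shearMonoL i ρ d (shearL i' G)) γ' = true))
  | U, .rel γ γ' zs nu κ subs => prelB q U G γ γ' zs nu κ && decide (zs ⊆ (subs.map Prod.fst).toFinset) &&
      pforest5B q rest G U subs
  | U, .split γ subs => psplitB q U G γ (subs.map Prod.fst).toFinset && pforest5B q rest G U subs
/-- subtree-list checker v5. OURS. [folklore] -/
def pforest5B (q : ℕ) (rest : List (PRow4 k)) (G : Terms 5 k) : Finset (Fin 4) → List (Fin 4 × PNode k) → Bool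
  | _, [] => true
  | U, (i, t) :: subs => pnode5B q rest G (U.erase i) t && pforest5B q rest G U subs
end

/-- the v5 row check. OURS. [folklore] -/
def prow5B (q : ℕ) (rest : List (PRow4 k)) : PRow4 k → Bool
  | (L, PRowCert4.blind c w α₀ a) => tfreeB L && ScopeBlind.blindB q (⟨trunc L, 0, ∅⟩ : SData 4 k) c w α₀ a
  | (L, PRowCert4.coat m e₀ ex) => pcoatB q L m e₀ ex
  | (L, PRowCert4.move S ch) => ppermB q S L &&
      decide (∀ j ∈ S, pnode5B q rest (chartL q (S5 S) j.castSucc L) (S.erase j) (ch j) = true)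

/-- **the v5 certificate checker** (v4 data, pair letter points may be dead). OURS. [folklore] -/
def pcert5B (q : ℕ) : List (PRow4 k) → Bool
  | [] => true
  | row :: rest => prow5B q rest row && pcert5B q rest

end Format

end LoopCLocal

end Summit.ResolutionOfSingularities.ResolutionOfSingularities.Theorems.PIDim4

end
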